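import Literature.MathematicalPhysics.QuantumFieldTheory.Balaban1983to89.B8LeafModelZd3

/-!
# `Balaban1983to89.B8Eq140PureGaugePotentialCStar` — the C⋆-ALGEBRA EDITION of `B8Eq140PureGaugePotential`: [Balaban1985RegularSpaces] (1.139)–(1.140) — ALL THREE MEMBERS — FOR A SCALAR PURE GAUGE `U₁ = e^{iηA}`,
# `A = −dψ∕η`, at `U₀ = 1` on NODE 00's carrier `zdGF3` (`d = 4`): the canonical masked logarithm IS `A`, the first member is `Lʲ|Δψ|`, the second
# `L^{2j}|ΔΔψ|`, the third (the linearised Maxwell operator `D*DA`) VANISHES IDENTICALLY on pure gauges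

statement-level skeleton of published theorems with citation tags; proofs where landed; nothing here is a claim about the Yang–Mills mass gap

T. Bałaban, *Spaces of regular gauge field configurations on a lattice and gauge fixing conditions*, Commun. Math. Phys. **99** (1985) 75–102
`[Balaban1985RegularSpaces]` ("B8"; journal page = PDF page + 74): (1.139)–(1.140) p. 100 («L^jη|A|, (L^jη)²|∇^η_{U₀}A|, (L^jη)³|D^{η*}_{U₀}D^η_{U₀}A| < α₂
on Ω_j»), (1.1) p. 76 (the covariant derivatives), p. 77 (the convention «bonds ∕ plaquettes on Ω_j»).  T. Bałaban, *Propagators for lattice gauge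
theories in a background field*, Commun. Math. Phys. **99** (1985) 389–434 `[Balaban1985BackgroundPropagators]`, (3.4) p. 391.

## WHY THIS FILE (cell `pub-ymgap`, HUMAN RULING D-0062 ∕ D-0149 ∕ D-0154; N05 = [B8]; width seat `pub-ymgap-dag-n05-w5` g3, CLAIM-2 of 2026-08-28T08:07Z)

Every P₇-currency certificate of the N05 lineage verifies the carrier's honest (1.140) predicate `zdGF3.C140` for its witness by hand, member by member
(`B8Prop7PrintedRZdGF3P2HalfSpaceAllL` §2 for the CONSTANT configuration).  The box-form certificate `B8Prop7PrintedRZdGF3BoxFormInterTower` needs it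
for a pure gauge with a NON-LINEAR potential `ψ`; this file proves it ONCE for every potential and every member all of whose bonds touch `Ω₀`, from two
displayed lattice-difference bounds — the reusable form.

## WHAT IS PROVED (kernel, 0 sorry; theorems only)

* (§1 of the scalar edition, `B8Eq140PureGaugePotential.sideTouches_coord_le`, is coordinate bookkeeping and is NOT restated.)
* §2 `plaqCovDeriv_potential_eq_zero` (the linearised plaquette field of `A = −dψ∕η` at `U₀ = 1` is `0`: `d² = 0`) and ★ `c140_zdGF3_potential`:
  `Lʲ·|ψ(y+e_τ) − ψ(y)| < α₂` and `L^{2j}·|Δ_κΔ_τψ(y)| < α₂` on the bonds touching `Ω_j` (`j ≤ k`), `16α₂ ≤ 1` ⟹ `(zdGF3 𝔸 L β len i).C140 α₂ U₀ P` for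
  `U₀ = 1`, `P = (U₀, e^{iηA})` (`mlogCfg_spec` gives `mlogCfg = A`).

## HONEST SCOPE

Bookkeeping of the typed hypothesis (1.140) on an explicit class of configurations; NO estimate of [Balaban1985RegularSpaces] is proved or asserted.
C⋆ edition: `A` is `ℂ·1`-valued in an arbitrary nontrivial C⋆-algebra `𝔸`.  Count-neutral helper keyed `stmt-QuantumFields-26907` (K1⁸ `StabilityBRunRowsAtRecordR13SepCoPH`, route rev 27; successor of the aside K1⁷ 20542); N05 NOT discharged; no summit statement is proved by this seat — R4 closes the
conditional finite-`𝕋⁴` rung `BalabanLadder.UV` only; nothing continuum ∕ ℝ⁴ ∕ OS ∕ mass-gap ∕ Clay.  No `sorry`, no `def`, no `instance`, no `notation`.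
Unit `pub-ymgap-dag-n05-w5` (g3), 2026-08-28.

[cite: Balaban1985RegularSpaces, (1.139)–(1.140) p.100, (1.1) p.76, p.77; Balaban1985BackgroundPropagators, (3.4) p.391]
-/

noncomputable section

open NormedSpace Finset

namespace Literature.MathematicalPhysics.QuantumFieldTheory.Balaban1983to89.B8Eq140PureGaugePotentialCStar

open Complex (I)
open B7Prop1Explicit B7Prop1Local
open B8Ineq132 (covDerivFwd)
open B8Eq140Level (SideTouches)
open B8Eq143PlaqExpansion (pdiv)
open B8Eq146AExpansion (plaqCovDeriv plaqCovDeriv_eq_covDerivFwd)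
open B8Eq184Proof (cfgExp)
open B8LeafModelZd (ZdIdx)
open B8LeafModelZd3 (zdGF3 mlogCfg mlogCfg_spec)

-- `Site` alone could resolve to the torus sites of `Setup.lean`; re-export the `ℤ^d` sites of `B7Prop1Explicit`.
export B7Prop1Explicit (Site)

/-! ## §2 (1.139)–(1.140) for a scalar PURE GAUGE `U₁ = e^{iηA}`, `A = −dψ∕η`, at `U₀ = 1`: the third member vanishes identically, the first two
are the first and second lattice differences of the potential -/

section C140

variable {L : ℕ} {𝔸 : Type} [CStarAlgebra 𝔸] [Nontrivial 𝔸]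

/-- The Lie-algebra configuration of the scalar pure gauge: `A(y, y+e_τ) = (ψ(y) − ψ(y+e_τ))∕η` (so that `e^{iηA} = g·1·g⁻¹`, `g = e^{iψ}`,
`B7GaugeFixingPureGauge.cfgExp_potential_eq_gaugeAct`).  Its norm is `|ψ(y+e_τ) − ψ(y)|∕η`. [cite: Balaban1985RegularSpaces, p.100 («U₁ = e^{iηA}»; bookkeeping)] -/
private theorem norm_potential {η : ℝ} (hη : 0 < η) (ψ : Site 4 → ℝ) (y : Site 4) (τ : Fin 4) :
    ‖algebraMap ℂ 𝔸 ((((ψ y - ψ (y + e τ)) / η : ℝ)) : ℂ)‖ = |ψ (y + e τ) - ψ y| * η⁻¹ := by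
  rw [norm_algebraMap', Complex.norm_real, Real.norm_eq_abs, abs_div, abs_of_pos hη, abs_sub_comm, div_eq_mul_inv]

/-- The forward covariant derivative (1.1) at `U₀ = 1` of the potential configuration is the second lattice difference of `ψ` over `η²`.
[cite: Balaban1985RegularSpaces, (1.1) p.76 (bookkeeping at `U₀ = 1`)] -/
private theorem norm_covDerivFwd_potential {η : ℝ} (hη : 0 < η) (ψ : Site 4 → ℝ) (y : Site 4) (τ κ : Fin 4) :
    ‖covDerivFwd η (1 : Site 4 → Fin 4 → 𝔸ˣ) κ (fun z => algebraMap ℂ 𝔸 ((((ψ z - ψ (z + e τ)) / η : ℝ)) : ℂ)) y‖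
      = |(ψ (y + e κ + e τ) - ψ (y + e κ)) - (ψ (y + e τ) - ψ y)| * (η⁻¹) ^ 2 := by
  simp only [covDerivFwd, B7Eq78Linearization.conjR_apply, Pi.one_apply, Units.val_one, inv_one, one_mul, mul_one]
  rw [norm_smul, Real.norm_eq_abs, abs_inv, abs_of_pos hη, ← map_sub, norm_algebraMap', ← Complex.ofReal_sub, Complex.norm_real, Real.norm_eq_abs,
    ← sub_div, abs_div, abs_of_pos hη]
  rw [show ψ (y + e κ) - ψ (y + e κ + e τ) - (ψ y - ψ (y + e τ)) = -((ψ (y + e κ + e τ) - ψ (y + e κ)) - (ψ (y + e τ) - ψ y)) by ring,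
    abs_neg]
  ring

omit [Nontrivial 𝔸] in
/-- **The third member of (1.140) VANISHES on a pure gauge**: the linearised plaquette field `(D^η_{U₀}A)(p) = D_μA_ν − D_νA_μ` of `A = −dψ∕η` at `U₀ = 1`
is the lattice curl of a lattice gradient, identically `0` (`d² = 0`). [cite: Balaban1985RegularSpaces, (1.140) p.100; Balaban1985BackgroundPropagators, (3.4) p.391] -/
theorem plaqCovDeriv_potential_eq_zero (η : ℝ) (ψ : Site 4 → ℝ) :
    plaqCovDeriv η (1 : Site 4 → Fin 4 → 𝔸ˣ) (fun z τ => algebraMap ℂ 𝔸 ((((ψ z - ψ (z + e τ)) / η : ℝ)) : ℂ)) = fun _ _ _ => 0 := by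
  funext μ ν x
  rw [plaqCovDeriv_eq_covDerivFwd]
  simp only [covDerivFwd, B7Eq78Linearization.conjR_apply, Pi.one_apply, Units.val_one, inv_one, one_mul, mul_one, ← smul_sub]
  rw [add_right_comm x (e ν) (e μ), ← map_sub, ← map_sub, ← map_sub]
  have : ((((ψ (x + e μ) - ψ (x + e μ + e ν)) / η : ℝ)) : ℂ) - ((((ψ x - ψ (x + e ν)) / η : ℝ)) : ℂ)
      - (((((ψ (x + e ν) - ψ (x + e μ + e ν)) / η : ℝ)) : ℂ) - ((((ψ x - ψ (x + e μ)) / η : ℝ)) : ℂ)) = 0 := by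
    push_cast; ring
  rw [this, map_zero, smul_zero]

/-- ★ **(1.140) — ALL THREE MEMBERS — FOR A SCALAR PURE GAUGE FROM TWO LATTICE-DIFFERENCE BOUNDS ON THE POTENTIAL** (NODE 00's carrier `zdGF3`, `d = 4`,
`U₀ = 1`, `U₁ = e^{iηA}`, `A = −dψ∕η`, any member `i` all of whose bonds touch `Ω₀`): if on every bond `⟨y, y+e_τ⟩` touching `Ω_j` (`j ≤ k`)
`Lʲ·|ψ(y+e_τ) − ψ(y)| < α₂` and `L^{2j}·|Δ_κΔ_τψ(y)| < α₂` for every `κ`, and `16α₂ ≤ 1`, then the carrier's honest (1.140) predicate `C140 α₂` holds: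
the canonical masked logarithm IS `A` (`mlogCfg_spec`), the first member is `Lʲ|Δψ|`, the second `L^{2j}|ΔΔψ|`, the third is `0`
(`plaqCovDeriv_potential_eq_zero`). [cite: Balaban1985RegularSpaces, (1.139)–(1.140) p.100, (1.1) p.76] -/
theorem c140_zdGF3_potential (hL : 1 ≤ L) (β : ℝ) (len : Site 4 → ℝ) (i : ZdIdx 4 L) (hall : ∀ (y : Site 4) (τ : Fin 4), SideTouches (i.Ω 0) y τ)
    (ψ : Site 4 → ℝ) {α₂ : ℝ} (hα : 0 < α₂) (hα16 : 16 * α₂ ≤ 1)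
    (h1 : ∀ j, j ≤ i.k → ∀ (y : Site 4) (τ : Fin 4), SideTouches (i.Ω j) y τ → (L : ℝ) ^ j * |ψ (y + e τ) - ψ y| < α₂)
    (h2 : ∀ j, j ≤ i.k → ∀ (y : Site 4) (τ κ : Fin 4), SideTouches (i.Ω j) y τ →
      ((L : ℝ) ^ j) ^ 2 * |(ψ (y + e κ + e τ) - ψ (y + e κ)) - (ψ (y + e τ) - ψ y)| < α₂)
    (U₀ : (zdGF3 𝔸 L β len i).Cfg) (hU₀ : U₀.1 = 1)
    (P : (zdGF3 𝔸 L β len i).Pert) (hP : P.2.1 = cfgExp i.η (fun z τ => algebraMap ℂ 𝔸 ((((ψ z - ψ (z + e τ)) / i.η : ℝ)) : ℂ))) :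
    (zdGF3 𝔸 L β len i).C140 α₂ U₀ P := by
  set A : Site 4 → Fin 4 → 𝔸 := fun z τ => algebraMap ℂ 𝔸 ((((ψ z - ψ (z + e τ)) / i.η : ℝ)) : ℂ) with hAdef
  have hη := i.hη
  have hAh : ∀ (y : Site 4) (κ : Fin 4), IsSelfAdjoint (A y κ) := fun _ _ => by
    rw [hAdef]; exact IsSelfAdjoint.algebraMap 𝔸 (Complex.conj_ofReal _)
  -- the hypothesis of `mlogCfg_spec`: `‖A‖ ≤ α₂ (Lʲη)⁻¹` on the bonds touching `Ω_j`
  have hWA : ∀ j, j ≤ i.k → ∀ (y : Site 4) (τ : Fin 4), SideTouches (i.Ω j) y τ →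
      P.2.1 y τ = cfgExp i.η A y τ ∧ ‖A y τ‖ ≤ α₂ * ((L : ℝ) ^ j * i.η)⁻¹ := by
    intro j hj y τ hst
    refine ⟨by rw [hP], ?_⟩
    rw [hAdef, norm_potential hη, mul_inv]
    have hLj : (0 : ℝ) < (L : ℝ) ^ j := by positivity
    have := h1 j hj y τ hst
    -- `|Δψ| ≤ α₂ / Lʲ`
    have hle : |ψ (y + e τ) - ψ y| ≤ α₂ * ((L : ℝ) ^ j)⁻¹ := by
      rw [← div_eq_mul_inv, le_div_iff₀ hLj, mul_comm]; exact this.le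
    calc |ψ (y + e τ) - ψ y| * i.η⁻¹ ≤ α₂ * ((L : ℝ) ^ j)⁻¹ * i.η⁻¹ :=
          mul_le_mul_of_nonneg_right hle (inv_nonneg.mpr hη.le)
      _ = α₂ * (((L : ℝ) ^ j)⁻¹ * i.η⁻¹) := by ring
  obtain ⟨hmsa, hmeq, -⟩ := mlogCfg_spec (W := P.2.1) hη hL i.k U₀.1 P.2.2 hα.le hα16 i.Ω hWA
  have hmA : mlogCfg i.k i.η i.Ω P.2.1 = A := by
    funext y τ
    exact (hmeq 0 (Nat.zero_le _) y τ (hall y τ)).1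
  intro j hj y τ hst
  rw [hmA, hU₀]
  have hLj : (0 : ℝ) < (L : ℝ) ^ j := by positivity
  refine ⟨(hWA j hj y τ hst).1, hAh y τ, ?_, fun κ => ?_, ?_⟩
  · -- first member: `Lʲη·‖A‖ = Lʲ|Δψ|`
    rw [hAdef, norm_potential hη]
    calc (L : ℝ) ^ j * i.η * (|ψ (y + e τ) - ψ y| * i.η⁻¹) = (L : ℝ) ^ j * |ψ (y + e τ) - ψ y| := by
          field_simp
      _ < α₂ := h1 j hj y τ hst
  · -- second member: `(Lʲη)²·‖D_κ A_τ‖ = L^{2j}|Δ_κΔ_τψ|`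
    rw [hAdef, norm_covDerivFwd_potential hη]
    calc ((L : ℝ) ^ j * i.η) ^ 2 * (|(ψ (y + e κ + e τ) - ψ (y + e κ)) - (ψ (y + e τ) - ψ y)| * (i.η⁻¹) ^ 2)
        = ((L : ℝ) ^ j) ^ 2 * |(ψ (y + e κ + e τ) - ψ (y + e κ)) - (ψ (y + e τ) - ψ y)| := by
          field_simp
      _ < α₂ := h2 j hj y τ κ hst
  · -- third member: identically zero
    rw [hAdef, plaqCovDeriv_potential_eq_zero]
    have h0 : pdiv i.η (1 : Site 4 → Fin 4 → 𝔸ˣ) (fun (_ _ : Fin 4) (_ : Site 4) => (0 : 𝔸)) τ y = 0 := by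
      simp [pdiv, B8Ineq132.covDeriv, B7Eq78Linearization.conjR_apply]
    rw [h0, norm_zero, mul_zero]
    exact hα

end C140

end Literature.MathematicalPhysics.QuantumFieldTheory.Balaban1983to89.B8Eq140PureGaugePotentialCStar

end
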